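import Summits.SmoothPoincare4.SmoothPoincare4.Theorems.CylinderEntropySliceIsolationStubCertHigh2CellsHi
import Mathlib
import HarnessLib

/-!
# High-scale certificate for the conformal kernel domination, `10 ≤ T ≤ 100` (stub `stub_certHigh2`)

Helper for the line `conformal-kernel-domination` of the crux
`Summit.SmoothPoincare4.SmoothPoincare4.Theses.CylinderEntropy.SliceIsolation` (crux item stmt-SmoothPoincare4-7632),
extending the landed flat + dipole certificate `stub_certHigh` (`T ≥ 100`) down to `T = 10`.
In the normalised variables `T = t/‖y‖² > 0`, `u = z₅ − log ‖y‖`, `s = ⟨z', ŷ⟩ ∈ [−1, 1]` the Jacobian-weighted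
pulled-back Euclidean Gaussian kernel times `V = 8π²/3` is
`pulled(T,u,s) = (8π²/3)((4πT)²)⁻¹ e^{4u} exp(−(e^{2u} − 2eᵘ s + 1)/(4T)) = Λ₄ e^{−b²/8} G(x) e^{bxs}`,
`b = √(2/T) ∈ [707/5000, 4473/10000]`, `x = eᵘ b/4`, `G(x) = x⁴ e^{2−2x²}`, `Λ₄ = 32/(3e²)`.  We dominate it on
`ℝ × [−1, 1]` by the flat atom plus TWO on-axis cylinder ("zonal") kernels of the dyadic scales `τ₁ = (log 2)/2`,
`τ₂ = log 2` (series weights `2^{−k(k+3)/2}(2k+3)/3`, `2^{−k(k+3)}(2k+3)/3`), both centred at the peak height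
`σ = ½ log(8T) = −log(b/4)` (height Gaussians `E₁(x) = exp(−(log x)²/(2 log 2))`, `E₂(x) = exp(−(log x)²/(4 log 2))`),
with weights `Λ₄ e^{−b²/8} (w̃₁(b), w̃₂(b), c̃(b))` AFFINE in `b` between
`(9/1000, 417/1000, 59197/100000)` at `b = 707/5000` and `(97/500, 687/1000, 799/5000)` at `b = 4473/10000`
(found by a linear programme; total `≤ K₀(1 + b₀(b−b₀)/4)`, `b₀ = 29/100`, the tangent of the mass budget
`(147/100) e^{b²/8}/Λ₄`, so that the mass is `≤ 147/100`, `certHigh2_mass`).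
Proof of the domination `G e^{bxs} ≤ c̃ + w̃₁ E₁ 𝔥(τ₁, s) + w̃₂ E₂ 𝔥(τ₂, s)` (`certHigh2_core`):
* far regions `x ≤ 7/20`, `x ≥ 2`: the flat atom alone (`certHigh2_far_left/right`, `G e^{bxs} ≤ 3/20 ≤ c̃`);
* `7/20 ≤ x ≤ 2`: `e^{bxs} ≤ Q₄(bxs)` (quartic, `|bxs| ≤ 9/10`), `P₁ ≤ 𝔥(τ₁, ·)`, `P₂ ≤ 𝔥(τ₂, ·)` (quartic/quadratic
  minorants), and the resulting sufficient inequality `F(b) := c̃ + w̃₁E₁P₁ + w̃₂E₂P₂ − G Q₄(bxs) ≥ 0` is CONCAVE in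
  `b` (weights affine, `Q₄` convex), hence follows from its two extreme cases `b = 707/5000`, `b = 4473/10000` — the
  registered helpers `helper_certHigh2CondsLo/Hi` of the aux files (eight `x`-cells each; on a cell `G ≤ Ĝ` quadratic,
  `Eⱼ ≥ 1 − κⱼ U(x)` from polynomial bounds of `(log x)²`, and a two-variable polynomial inequality certified by its
  tensor Bernstein coefficients).  Numerically the scheme keeps `≥ 1 %` pointwise slack; the LP optimum of this
  two-atom family is `≈ 1.441–1.447` on `[10, 100]`.
-/

noncomputable section

-- the registered namespace `Summit.SmoothPoincare4.SmoothPoincare4.Theorems…` repeats a component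
set_option linter.dupNamespace false

namespace Summit.SmoothPoincare4.SmoothPoincare4.Theorems.CylinderEntropySliceIsolation

open Literature.Geometry.Riemannian Literature.Geometry.Riemannian.SphericalCylinderEntropy
open Literature.Geometry.Riemannian.SphericalZonalKernelSeries (zonal_nonneg)

/-! ### The far regions: the flat atom alone -/

/-- Far left `0 ≤ x ≤ 7/20`: `G(x) e^{bxs} ≤ (7/20)⁴ e² e^{0.157} ≤ 3/20` for `0 ≤ b ≤ 4473/10000`,
`|s| ≤ 1`. [folklore] -/
theorem certHigh2_far_left {b x s : ℝ} (hb0 : 0 ≤ b) (hb : b ≤ 4473 / 10000) (hx0 : 0 ≤ x)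
    (hx : x ≤ 7 / 20) (hs1 : -1 ≤ s) (hs2 : s ≤ 1) :
    x ^ 4 * Real.exp (2 - 2 * x ^ 2) * Real.exp (b * x * s) ≤ 3 / 20 := by
  have he : Real.exp 1 < 2.7182818286 := Real.exp_one_lt_d9
  have h1 : Real.exp (2 - 2 * x ^ 2) ≤ Real.exp 1 ^ 2 := by
    rw [← Real.exp_nat_mul]
    exact Real.exp_le_exp.2 (by push_cast; nlinarith)
  have h2 : Real.exp 1 ^ 2 ≤ 73891 / 10000 := by nlinarith [Real.exp_pos 1]
  have hbx : b * x ≤ 4473 / 10000 * (7 / 20) := mul_le_mul hb hx hx0 (by norm_num)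
  have hy : |b * x * s| ≤ 4473 / 10000 * (7 / 20) := by
    rw [abs_mul, abs_of_nonneg (mul_nonneg hb0 hx0)]
    have hs : |s| ≤ 1 := abs_le.2 ⟨hs1, hs2⟩
    nlinarith [mul_le_mul hbx hs (abs_nonneg s) (by norm_num), mul_nonneg hb0 hx0]
  have h3 : Real.exp (b * x * s) ≤ 11811 / 10000 := by
    have h4 := Real.abs_exp_sub_one_sub_id_le (x := b * x * s) (hy.trans (by norm_num))
    have h5 := (abs_le.1 h4).2
    have h6 := (abs_le.1 hy).2
    have h7 : (b * x * s) ^ 2 ≤ (4473 / 10000 * (7 / 20)) ^ 2 := by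
      rw [← sq_abs]; exact pow_le_pow_left₀ (abs_nonneg _) hy 2
    nlinarith
  have hx4 : x ^ 4 ≤ (7 / 20) ^ 4 := pow_le_pow_left₀ hx0 hx 4
  calc x ^ 4 * Real.exp (2 - 2 * x ^ 2) * Real.exp (b * x * s)
      ≤ (7 / 20) ^ 4 * (73891 / 10000) * (11811 / 10000) := by
        refine mul_le_mul (mul_le_mul hx4 (h1.trans h2) (Real.exp_pos _).le (by norm_num)) h3
          (Real.exp_pos _).le (by norm_num)
    _ ≤ 3 / 20 := by norm_num

/-- Far right `x ≥ 2`: `bxs ≤ (4473/10000)(x²/4 + 1)`, so `G e^{bxs} ≤ x⁴ e^{−t}`,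
`t = (75527/40000) x² − 24473/10000 ≥ 0`, and `x⁴ ≤ (3/20) T₆(t) ≤ (3/20) eᵗ`. [folklore] -/
theorem certHigh2_far_right {b x s : ℝ} (hb0 : 0 ≤ b) (hb : b ≤ 4473 / 10000) (hx : 2 ≤ x)
    (hs2 : s ≤ 1) :
    x ^ 4 * Real.exp (2 - 2 * x ^ 2) * Real.exp (b * x * s) ≤ 3 / 20 := by
  have hx0 : 0 ≤ x := by linarith
  have hbxs : b * x * s ≤ 4473 / 10000 * (x ^ 2 / 4 + 1) := by
    have h1 : b * x * s ≤ b * x := by nlinarith [mul_nonneg hb0 hx0]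
    have h2 : b * x ≤ 4473 / 10000 * x := mul_le_mul_of_nonneg_right hb hx0
    nlinarith [sq_nonneg (x - 2)]
  set t := 75527 / 40000 * x ^ 2 - 24473 / 10000 with ht
  have hv : 0 ≤ x ^ 2 - 4 := by nlinarith
  have ht0 : 0 ≤ t := by rw [ht]; nlinarith
  have hexp : Real.exp (2 - 2 * x ^ 2) * Real.exp (b * x * s) ≤ Real.exp (-t) := by
    rw [← Real.exp_add]; exact Real.exp_le_exp.2 (by rw [ht]; linarith)
  have hT := Real.sum_le_exp_of_nonneg ht0 7
  simp only [Finset.sum_range_succ, Finset.sum_range_zero, Nat.factorial] at hT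
  norm_num at hT
  have hpoly : x ^ 4 ≤ 3 / 20 * (1 + t + t ^ 2 / 2 + t ^ 3 / 6 + t ^ 4 / 24 + t ^ 5 / 120 + t ^ 6 / 720) := by
    rw [ht]
    linarith [pow_nonneg hv 2, pow_nonneg hv 3, pow_nonneg hv 4, pow_nonneg hv 5, pow_nonneg hv 6]
  have hinv : Real.exp (-t) * Real.exp t = 1 := by rw [← Real.exp_add]; simp
  have h6 : x ^ 4 * Real.exp (-t) ≤ 3 / 20 := by
    have h7 : x ^ 4 ≤ 3 / 20 * Real.exp t := by linarith
    nlinarith [mul_le_mul_of_nonneg_right h7 (Real.exp_pos (-t)).le, hinv]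
  calc x ^ 4 * Real.exp (2 - 2 * x ^ 2) * Real.exp (b * x * s)
      = x ^ 4 * (Real.exp (2 - 2 * x ^ 2) * Real.exp (b * x * s)) := by ring
    _ ≤ x ^ 4 * Real.exp (-t) := mul_le_mul_of_nonneg_left hexp (by positivity)
    _ ≤ 3 / 20 := h6

/-! ### The mass bound -/

/-- **Mass**: with `Λ₄ = 32/(3e²)`, `K₀ = 5145327/5000000 ≤ (147/100)(3e²/32)(1 + b₀²/8 + b₀⁴/128)`,
`b₀ = 29/100`: `Λ₄ e^{−b²/8} K₀ (1 + b₀(b − b₀)/4) ≤ 147/100` for `b ≥ 0`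
(`e^{b²/8} ≥ (1 + b₀²/8 + b₀⁴/128)(1 + b₀(b−b₀)/4)`, `e ≥ 2.7182818283`). [folklore] -/
theorem certHigh2_mass {b : ℝ} (hb : 0 ≤ b) :
    32 / (3 * Real.exp 1 ^ 2) * Real.exp (-(b ^ 2 / 8)) *
        (5145327 / 5000000 * (1 + 29 / 100 * (b - 29 / 100) / 4)) ≤ 147 / 100 := by
  set l := 1 + 29 / 100 * (b - 29 / 100) / 4 with hl
  have hl0 : 0 ≤ l := by rw [hl]; nlinarith
  have he : (2.7182818283 : ℝ) < Real.exp 1 := Real.exp_one_gt_d9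
  have hA : (1 : ℝ) + (29 / 100) ^ 2 / 8 + (29 / 100) ^ 4 / 128 ≤ Real.exp ((29 / 100) ^ 2 / 8) := by
    have := Real.quadratic_le_exp_of_nonneg (x := (29 / 100 : ℝ) ^ 2 / 8) (by norm_num)
    norm_num at this ⊢; linarith
  have hB : l ≤ Real.exp ((b ^ 2 - (29 / 100) ^ 2) / 8) := by
    have := Real.add_one_le_exp ((b ^ 2 - (29 / 100) ^ 2) / 8)
    rw [hl]; nlinarith [sq_nonneg (b - 29 / 100)]
  have hAB : ((1 : ℝ) + (29 / 100) ^ 2 / 8 + (29 / 100) ^ 4 / 128) * l ≤ Real.exp (b ^ 2 / 8) := by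
    have hsplit : Real.exp (b ^ 2 / 8) = Real.exp ((29 / 100) ^ 2 / 8) * Real.exp ((b ^ 2 - (29 / 100) ^ 2) / 8) := by
      rw [← Real.exp_add]; congr 1; ring
    rw [hsplit]
    exact mul_le_mul hA hB hl0 (Real.exp_pos _).le
  have he2 : (2.7182818283 : ℝ) ^ 2 ≤ Real.exp 1 ^ 2 := pow_le_pow_left₀ (by norm_num) he.le 2
  have hinv : Real.exp (-(b ^ 2 / 8)) * Real.exp (b ^ 2 / 8) = 1 := by rw [← Real.exp_add]; simp
  have hpos : 0 < 3 * Real.exp 1 ^ 2 := by positivity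
  rw [div_mul_eq_mul_div, div_mul_eq_mul_div, div_le_iff₀ hpos]
  have h1 : 32 * (5145327 / 5000000 * l) ≤
      441 / 100 * (2.7182818283 : ℝ) ^ 2 * ((1 + (29 / 100) ^ 2 / 8 + (29 / 100) ^ 4 / 128) * l) := by
    rw [hl]; norm_num; nlinarith
  have h2 : 441 / 100 * (2.7182818283 : ℝ) ^ 2 * ((1 + (29 / 100) ^ 2 / 8 + (29 / 100) ^ 4 / 128) * l) ≤
      441 / 100 * Real.exp 1 ^ 2 * Real.exp (b ^ 2 / 8) :=
    mul_le_mul (mul_le_mul_of_nonneg_left he2 (by norm_num)) hAB (mul_nonneg (by norm_num) hl0)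
      (by positivity)
  have h3 := mul_le_mul_of_nonneg_right (h1.trans h2) (Real.exp_pos (-(b ^ 2 / 8))).le
  calc 32 * Real.exp (-(b ^ 2 / 8)) * (5145327 / 5000000 * l)
      = 32 * (5145327 / 5000000 * l) * Real.exp (-(b ^ 2 / 8)) := by ring
    _ ≤ 441 / 100 * Real.exp 1 ^ 2 * Real.exp (b ^ 2 / 8) * Real.exp (-(b ^ 2 / 8)) := h3
    _ = 147 / 100 * (3 * Real.exp 1 ^ 2) := by
        rw [mul_assoc, mul_comm (Real.exp (b ^ 2 / 8)), hinv]; ring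

/-! ### The normalised certificate, all dipole sizes -/

/-- **The normalised certificate** for `b = (1−l)·707/5000 + l·4473/10000`, `l ∈ [0, 1]`, `x > 0`, `|s| ≤ 1`:
`G(x) e^{bxs} ≤ c̃ + w̃₁ E₁(x) 𝔥((log 2)/2, s) + w̃₂ E₂(x) 𝔥(log 2, s)` with the affine weights
(far regions by the flat atom; in between `e^{bxs} ≤ Q₄(bxs)`, concavity in `b` from the chord inequality of
`Q₄`, the two extreme cases `helper_certHigh2CondsLo/Hi`, and the minorants `P₁, P₂` of the zonal kernels).
[folklore] -/
theorem certHigh2_core {b l x s : ℝ} (hl0 : 0 ≤ l) (hl1 : l ≤ 1)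
    (hb : b = (1 - l) * (707 / 5000) + l * (4473 / 10000)) (hx : 0 < x) (hs1 : -1 ≤ s) (hs2 : s ≤ 1) :
    x ^ 4 * Real.exp (2 - 2 * x ^ 2) * Real.exp (b * x * s) ≤
      ((1 - l) * (59197 / 100000) + l * (799 / 5000)) +
        ((1 - l) * (9 / 1000) + l * (97 / 500)) *
          (Real.exp (-Real.log x ^ 2 / (2 * Real.log 2)) * zonal (Real.log 2 / 2) s) +
        ((1 - l) * (417 / 1000) + l * (687 / 1000)) *
          (Real.exp (-Real.log x ^ 2 / (4 * Real.log 2)) * zonal (Real.log 2) s) := by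
  have hb0 : 0 ≤ b := by rw [hb]; linarith
  have hb1 : b ≤ 4473 / 10000 := by rw [hb]; linarith
  have hL : 0 < Real.log 2 := Real.log_pos one_lt_two
  have hZ1 : 0 ≤ zonal (Real.log 2 / 2) s := zonal_nonneg (by positivity) s ⟨hs1, hs2⟩
  have hZ2 : 0 ≤ zonal (Real.log 2) s := zonal_nonneg hL s ⟨hs1, hs2⟩
  have hE₁0 : 0 ≤ Real.exp (-Real.log x ^ 2 / (2 * Real.log 2)) := (Real.exp_pos _).le
  have hE₂0 : 0 ≤ Real.exp (-Real.log x ^ 2 / (4 * Real.log 2)) := (Real.exp_pos _).le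
  have hw₁ : 0 ≤ (1 - l) * (9 / 1000) + l * (97 / 500) := by linarith
  have hw₂ : 0 ≤ (1 - l) * (417 / 1000) + l * (687 / 1000) := by linarith
  have hA1 : 0 ≤ ((1 - l) * (9 / 1000) + l * (97 / 500)) *
      (Real.exp (-Real.log x ^ 2 / (2 * Real.log 2)) * zonal (Real.log 2 / 2) s) :=
    mul_nonneg hw₁ (mul_nonneg hE₁0 hZ1)
  have hA2 : 0 ≤ ((1 - l) * (417 / 1000) + l * (687 / 1000)) *
      (Real.exp (-Real.log x ^ 2 / (4 * Real.log 2)) * zonal (Real.log 2) s) :=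
    mul_nonneg hw₂ (mul_nonneg hE₂0 hZ2)
  rcases le_or_gt x (7 / 20) with hxl | hxl
  · have := certHigh2_far_left hb0 hb1 hx.le hxl hs1 hs2
    linarith
  rcases le_or_gt 2 x with hxr | hxr
  · have := certHigh2_far_right hb0 hb1 hxr hs2
    linarith
  -- the middle region: concavity in `b` between the two certified extreme cases
  have hsabs : |s| ≤ 1 := abs_le.2 ⟨hs1, hs2⟩
  have hxs : |x * s| ≤ 2 := by
    rw [abs_mul, abs_of_pos hx]
    have := mul_le_mul hxr.le hsabs (abs_nonneg s) (by norm_num : (0 : ℝ) ≤ 2)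
    linarith
  have h0 : |707 / 5000 * x * s| ≤ 1 := by
    rw [mul_assoc, abs_mul, abs_of_pos (by norm_num : (0 : ℝ) < 707 / 5000)]; linarith
  have h1 : |4473 / 10000 * x * s| ≤ 1 := by
    rw [mul_assoc, abs_mul, abs_of_pos (by norm_num : (0 : ℝ) < 4473 / 10000)]; linarith
  have hbxs : |b * x * s| ≤ 9 / 10 := by
    rw [mul_assoc, abs_mul, abs_of_nonneg hb0]
    have := mul_le_mul hb1 hxs (abs_nonneg _) (by norm_num : (0 : ℝ) ≤ 4473 / 10000)
    linarith
  have hchord := certHigh2_Q4_chord (y₀ := 707 / 5000 * x * s) (y₁ := 4473 / 10000 * x * s) hl0 hl1 h0 h1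
  have hy : (1 - l) * (707 / 5000 * x * s) + l * (4473 / 10000 * x * s) = b * x * s := by rw [hb]; ring
  rw [hy] at hchord
  have hexp := certHigh2_exp_le_Q4 hbxs
  have hG0 : 0 ≤ x ^ 4 * Real.exp (2 - 2 * x ^ 2) := by positivity
  -- `G e^{bxs} ≤ G Q₄(bxs) ≤ (1-l) G Q₄(y₀) + l G Q₄(y₁)`
  have step1 := mul_le_mul_of_nonneg_left (hexp.trans hchord) hG0
  -- the minorants of the zonal kernels
  have hZP1 := mul_le_mul_of_nonneg_left (certHigh2_zonal_half_lower hs1 hs2) (mul_nonneg hw₁ hE₁0)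
  have hZP2 := mul_le_mul_of_nonneg_left (certHigh_zonal_lower hs1 hs2) (mul_nonneg hw₂ hE₂0)
  -- the two extreme cases
  have Hlo := mul_le_mul_of_nonneg_left (helper_certHigh2CondsLo x s hxl.le hxr.le hs1 hs2)
    (show (0 : ℝ) ≤ 1 - l by linarith)
  have Hhi := mul_le_mul_of_nonneg_left (helper_certHigh2CondsHi x s hxl.le hxr.le hs1 hs2) hl0
  linarith [step1, Hlo, Hhi, hZP1, hZP2]

/-- **High-scale certificate on `10 ≤ T ≤ 100`** (the flat atom plus TWO on-axis cylinder kernels of scales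
`τ₁ = (log 2)/2`, `τ₂ = log 2` centred at the peak height `σ = ½ log(8T)`, weights affine in `b = √(2/T)` times
`Λ₄ e^{−b²/8}`, total mass `≤ 147/100`): registered stub `stub_certHigh2` of the line
`conformal-kernel-domination`. [folklore] -/
theorem stub_certHigh2 :
    ∀ T : ℝ, 10 ≤ T → T ≤ 100 → ∃ σ₁ τ₁ w₁ σ₂ τ₂ w₂ c : ℝ, 0 < τ₁ ∧ 0 < τ₂ ∧ 0 ≤ w₁ ∧ 0 ≤ w₂ ∧ 0 ≤ c ∧ w₁ + w₂ + c ≤ 147 / 100 ∧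
      ∀ u s : ℝ, -1 ≤ s → s ≤ 1 →
        (8 * Real.pi ^ 2 / 3) * ((4 * Real.pi * T) ^ 2)⁻¹ * Real.exp (4 * u) *
            Real.exp (-(Real.exp (2 * u) - 2 * Real.exp u * s + 1) / (4 * T)) ≤
          w₁ * (zonal τ₁ s * Real.exp (-(u - σ₁) ^ 2 / (4 * τ₁))) + w₂ * (zonal τ₂ s * Real.exp (-(u - σ₂) ^ 2 / (4 * τ₂))) + c := by
  intro T hT hT2
  have hT0 : 0 < T := by linarith
  set b : ℝ := Real.sqrt (2 / T) with hbdef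
  have hb0 : 0 < b := Real.sqrt_pos.2 (by positivity)
  have hb2 : b ^ 2 = 2 / T := Real.sq_sqrt (by positivity)
  have hblo : 707 / 5000 ≤ b := by
    rw [hbdef, Real.le_sqrt (by norm_num) (by positivity), le_div_iff₀ hT0]; nlinarith
  have hbhi : b ≤ 4473 / 10000 := by
    rw [hbdef, Real.sqrt_le_left (by norm_num), div_le_iff₀ hT0]; nlinarith
  set l : ℝ := (b - 707 / 5000) / (4473 / 10000 - 707 / 5000) with hldef
  have hl0 : 0 ≤ l := div_nonneg (by linarith) (by norm_num)
  have hl1 : l ≤ 1 := by rw [hldef, div_le_one (by norm_num)]; linarith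
  have hbl : b = (1 - l) * (707 / 5000) + l * (4473 / 10000) := by rw [hldef]; field_simp; ring
  set Λ : ℝ := 32 / (3 * Real.exp 1 ^ 2) with hΛ
  have hΛ0 : 0 < Λ := by positivity
  set f : ℝ := Λ * Real.exp (-(b ^ 2 / 8)) with hf
  have hf0 : 0 < f := by positivity
  set cw : ℝ := (1 - l) * (59197 / 100000) + l * (799 / 5000) with hcw
  set w1 : ℝ := (1 - l) * (9 / 1000) + l * (97 / 500) with hw1
  set w2 : ℝ := (1 - l) * (417 / 1000) + l * (687 / 1000) with hw2
  have hcw0 : 0 ≤ cw := by rw [hcw]; nlinarith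
  have hw10 : 0 ≤ w1 := by rw [hw1]; nlinarith
  have hw20 : 0 ≤ w2 := by rw [hw2]; nlinarith
  refine ⟨-Real.log (b / 4), Real.log 2 / 2, f * w1, -Real.log (b / 4), Real.log 2, f * w2, f * cw,
    by positivity, Real.log_pos one_lt_two, mul_nonneg hf0.le hw10, mul_nonneg hf0.le hw20,
    mul_nonneg hf0.le hcw0, ?_, ?_⟩
  · -- the mass
    have htot : w1 + w2 + cw ≤ 5145327 / 5000000 * (1 + 29 / 100 * (b - 29 / 100) / 4) := by
      rw [hw1, hw2, hcw, hbl]; nlinarith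
    have hmass := certHigh2_mass hb0.le
    calc f * w1 + f * w2 + f * cw = f * (w1 + w2 + cw) := by ring
      _ ≤ f * (5145327 / 5000000 * (1 + 29 / 100 * (b - 29 / 100) / 4)) :=
          mul_le_mul_of_nonneg_left htot hf0.le
      _ ≤ 147 / 100 := by rw [hf, hΛ]; exact hmass
  · intro u s hs1 hs2
    set r := Real.exp u with hr
    have hr0 : 0 < r := Real.exp_pos u
    set x := r * b / 4 with hx
    have hx0 : 0 < x := by positivity
    have hcore := certHigh2_core hl0 hl1 hbl hx0 hs1 hs2
    rw [← hcw, ← hw1, ← hw2] at hcore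
    -- rewrite the left-hand side in the normalised variables
    have hpre : (8 * Real.pi ^ 2 / 3) * ((4 * Real.pi * T) ^ 2)⁻¹ = 1 / (6 * T ^ 2) := by
      have hπ : Real.pi ≠ 0 := Real.pi_ne_zero
      field_simp
      ring
    have h4 : Real.exp (4 * u) = r ^ 4 := by rw [hr, ← Real.exp_nat_mul]; norm_num
    have h2 : Real.exp (2 * u) = r ^ 2 := by rw [hr, ← Real.exp_nat_mul]; norm_num
    have hTb : T = 2 / b ^ 2 := by rw [hb2]; field_simp
    have harg : -(r ^ 2 - 2 * r * s + 1) / (4 * T) =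
        (2 - 2 * x ^ 2) + b * x * s + (-(b ^ 2 / 8) + -2) := by
      rw [hTb, hx]; field_simp; ring
    have hexp : Real.exp (-(r ^ 2 - 2 * r * s + 1) / (4 * T)) =
        Real.exp (2 - 2 * x ^ 2) * Real.exp (b * x * s) * (Real.exp (-(b ^ 2 / 8)) * (Real.exp 1 ^ 2)⁻¹) := by
      rw [harg, Real.exp_add, Real.exp_add]
      congr 1
      rw [Real.exp_add, ← Real.exp_nat_mul, ← Real.exp_neg]
      norm_num
    have hcoef : 1 / (6 * T ^ 2) * r ^ 4 = 32 / 3 * x ^ 4 := by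
      rw [hTb, hx]; field_simp; ring
    -- the height Gaussians of the atoms
    have hσ : u - -Real.log (b / 4) = Real.log x := by
      rw [hx, hr, show Real.exp u * b / 4 = Real.exp u * (b / 4) by ring,
        Real.log_mul (Real.exp_pos u).ne' (by positivity), Real.log_exp]
      ring
    have hG1 : Real.exp (-(u - -Real.log (b / 4)) ^ 2 / (4 * (Real.log 2 / 2))) =
        Real.exp (-Real.log x ^ 2 / (2 * Real.log 2)) := by
      rw [hσ]; congr 1; ring
    have hG2 : Real.exp (-(u - -Real.log (b / 4)) ^ 2 / (4 * Real.log 2)) =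
        Real.exp (-Real.log x ^ 2 / (4 * Real.log 2)) := by
      rw [hσ]
    rw [hpre, h4, h2, hexp, hG1, hG2]
    have hmain := mul_le_mul_of_nonneg_left hcore hf0.le
    calc 1 / (6 * T ^ 2) * r ^ 4 *
          (Real.exp (2 - 2 * x ^ 2) * Real.exp (b * x * s) * (Real.exp (-(b ^ 2 / 8)) * (Real.exp 1 ^ 2)⁻¹))
        = f * (x ^ 4 * Real.exp (2 - 2 * x ^ 2) * Real.exp (b * x * s)) := by
          rw [show 1 / (6 * T ^ 2) * r ^ 4 *
              (Real.exp (2 - 2 * x ^ 2) * Real.exp (b * x * s) * (Real.exp (-(b ^ 2 / 8)) * (Real.exp 1 ^ 2)⁻¹))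
              = (1 / (6 * T ^ 2) * r ^ 4) *
              (Real.exp (2 - 2 * x ^ 2) * Real.exp (b * x * s) * (Real.exp (-(b ^ 2 / 8)) * (Real.exp 1 ^ 2)⁻¹))
              by ring, hcoef, hf, hΛ]
          field_simp
      _ ≤ f * (cw + w1 * (Real.exp (-Real.log x ^ 2 / (2 * Real.log 2)) * zonal (Real.log 2 / 2) s) +
            w2 * (Real.exp (-Real.log x ^ 2 / (4 * Real.log 2)) * zonal (Real.log 2) s)) := hmain
      _ = f * w1 * (zonal (Real.log 2 / 2) s * Real.exp (-Real.log x ^ 2 / (2 * Real.log 2))) +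
            f * w2 * (zonal (Real.log 2) s * Real.exp (-Real.log x ^ 2 / (4 * Real.log 2))) + f * cw := by
          ring

end Summit.SmoothPoincare4.SmoothPoincare4.Theorems.CylinderEntropySliceIsolation

end
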